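import Summits.AtomisticToContinuum.Crystallization.Theorems.ThreeConeCertificateKeplerBoundLocLimMain
import Summits.AtomisticToContinuum.Crystallization.Theorems.ThreeConeCertificateDefectVanishCrystallizes

/-!
# `KeplerBound` (stmt-AtomisticToContinuum-11961) from local limits, V: periodic configurations
# charged by ground states are periodic minimisers

Support file for the item `ThreeConeCertificate.KeplerBound`.  A periodic configuration `Q` of
`ℝ³` is CHARGED by a family of Lennard-Jones ground states `x^N` if at every scale `(R, ε)`, for
infinitely many `N`, some particle `i` of `x^N` has its `R`-environment two-way `ε`-matched to
`x i + A (Q.points − q)` for a linear isometry `A` and a site `q ∈ Q.points` (the hypothesis of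
the shared item `ChargedPeriodicIsOptimal`, stmt-AtomisticToContinuum-2913, with "positive density
`ρN` of such particles" weakened to "at least one").  Then some rotated, recentred copy of `Q` is a
local limit of translated ground states (`exists_isLocalLimit_of_charged`: reduce the sites `q`
to the finitely many motif classes, pigeonhole, extract converging charts by compactness of
`O(3)` — `eventually_matched_isometryImage` of the tree), so by part III and the invariance of
the energy per particle under isometries and translations, `e(Q) = e*`: `Q` is a periodic
minimiser (`isLeast_of_charged`) and `KeplerBound` holds (`keplerBound_of_charged`).
All `[folklore]`.
-/

noncomputable section

open scoped BigOperators Topology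
open Filter Set Metric

namespace Summit.AtomisticToContinuum.Crystallization.Theorems.KeplerBoundLocalLimit

open Literature.MathematicalPhysics.StatisticalMechanics
open Summit.AtomisticToContinuum.Crystallization.Theorems.SlackRigidityNegative (E3)
open Summit.AtomisticToContinuum.Crystallization.Theorems.ChargedEnergyGapNegative (eStar eStar_le)
open Summit.AtomisticToContinuum.Crystallization.Theorems.ThreeConeCertificateDefectVanishCrystallizes
  (eventually_matched_isometryImage)
open Summit.AtomisticToContinuum.Crystallization.Theses.ThreeConeCertificate (KeplerBound)

/-- **A charged periodic configuration has a rotated recentred copy in `𝔏`.** [folklore] -/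
theorem exists_isLocalLimit_of_charged {Q : PeriodicConfiguration 3}
    (x : (N : ℕ) → Fin N → E3) (hx : ∀ N, IsGroundState lennardJones (x N))
    (h : ∀ R ε : ℝ, 0 < R → 0 < ε → ∃ᶠ N in atTop, ∃ (i : Fin N) (A : E3 →ₗᵢ[ℝ] E3),
      ∃ q ∈ Q.points,
        (∀ s ∈ Q.points, dist s q ≤ R → ∃ j, dist (x N j) (x N i + A (s - q)) ≤ ε) ∧
        (∀ j, dist (x N j) (x N i) ≤ R → ∃ s ∈ Q.points, dist (x N j) (x N i + A (s - q)) ≤ ε)) :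
    ∃ (z : E3) (B : E3 ≃ₗᵢ[ℝ] E3),
      IsLocalLimitOfGroundStates lennardJones 3 ((Q.translate (-z)).isometryImage B).points := by
  classical
  -- one charged ground state per scale `k` (radius `k + 1`, tolerance `1/(k + 1)`)
  have hk : ∀ k : ℕ, ∃ᶠ N in atTop, ∃ (i : Fin N) (A : E3 →ₗᵢ[ℝ] E3), ∃ q ∈ Q.points,
      (∀ s ∈ Q.points, dist s q ≤ (k : ℝ) + 1 →
        ∃ j, dist (x N j) (x N i + A (s - q)) ≤ 1 / ((k : ℝ) + 1)) ∧
      (∀ j, dist (x N j) (x N i) ≤ (k : ℝ) + 1 →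
        ∃ s ∈ Q.points, dist (x N j) (x N i + A (s - q)) ≤ 1 / ((k : ℝ) + 1)) :=
    fun k => h _ _ (by positivity) (by positivity)
  obtain ⟨φ, hφ, hφP⟩ := extraction_forall_of_frequently hk
  choose i A q hq hmatch using hφP
  -- motif representatives of the sites, and a constant one along a subsequence
  have hrep : ∀ k, ∃ z : Q.motif, q k - z.1 ∈ Q.lattice := fun k => by
    obtain ⟨z, hz, hqz⟩ := Q.exists_sub_mem_lattice (hq k)
    exact ⟨⟨z, hz⟩, hqz⟩
  choose z hz using hrep
  obtain ⟨z₀, hz₀⟩ := Finite.exists_infinite_fiber z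
  have hfreq : ∃ᶠ k in atTop, z k = z₀ :=
    Nat.frequently_atTop_iff_infinite.2 (Set.infinite_coe_iff.1 hz₀)
  obtain ⟨ψ₁, hψ₁, hψ₁z⟩ := extraction_of_frequently_atTop hfreq
  -- the recentred template and configurations
  set P' : PeriodicConfiguration 3 := Q.translate (-(z₀ : E3)) with hP'
  have hP'mem : ∀ p : E3, p ∈ P'.points ↔ p + z₀ ∈ Q.points := fun p => by
    rw [hP', Q.mem_points_translate, sub_neg_eq_add]
  set n : ℕ → ℕ := fun l => φ (ψ₁ l) with hn
  set y : (l : ℕ) → Fin (n l) → E3 := fun l j => x (n l) j - x (n l) (i (ψ₁ l)) with hy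
  set A' : ℕ → E3 →ₗᵢ[ℝ] E3 := fun l => A (ψ₁ l) with hA'
  have hdist : ∀ l (j : Fin (n l)) (p : E3),
      dist (y l j) (A' l p) = dist (x (n l) j) (x (n l) (i (ψ₁ l)) + A (ψ₁ l) p) := by
    intro l j p
    simp only [hy, hA', dist_eq_norm]
    congr 1
    abel
  have hscale : ∀ l : ℕ, (l : ℝ) + 1 ≤ (ψ₁ l : ℝ) + 1 ∧ 1 / ((ψ₁ l : ℝ) + 1) ≤ 1 / ((l : ℝ) + 1) := by
    intro l
    have h1 : (l : ℝ) ≤ ψ₁ l := by exact_mod_cast hψ₁.le_apply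
    exact ⟨by linarith, one_div_le_one_div_of_le (by positivity) (by linarith)⟩
  have hy' : ∀ l : ℕ,
      (∀ p ∈ P'.points, ‖p‖ ≤ (l : ℝ) + 1 → ∃ j, dist (y l j) (A' l p) ≤ 1 / ((l : ℝ) + 1)) ∧
      (∀ j, ‖y l j‖ ≤ (l : ℝ) + 1 → ∃ p ∈ P'.points, dist (y l j) (A' l p) ≤ 1 / ((l : ℝ) + 1)) := by
    intro l
    obtain ⟨ha, hb⟩ := hmatch (ψ₁ l)
    have hzl : (z (ψ₁ l) : E3) = z₀ := by rw [hψ₁z l]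
    have hlat : q (ψ₁ l) - (z₀ : E3) ∈ Q.lattice := by rw [← hzl]; exact hz (ψ₁ l)
    constructor
    · intro p hp hpl
      -- the site `s = p + q` of `Q`
      have hs : p + q (ψ₁ l) ∈ Q.points := by
        have := Q.add_mem_points ((hP'mem p).1 hp) hlat
        convert this using 1
        abel
      obtain ⟨j, hj⟩ := ha _ hs (by
        rw [dist_eq_norm, add_sub_cancel_right]; linarith [(hscale l).1])
      refine ⟨j, ?_⟩
      rw [hdist, ← add_sub_cancel_right p (q (ψ₁ l))]
      exact hj.trans (hscale l).2
    · intro j hj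
      have hjr : dist (x (n l) j) (x (n l) (i (ψ₁ l))) ≤ (ψ₁ l : ℝ) + 1 := by
        rw [dist_eq_norm]
        exact hj.trans (hscale l).1
      obtain ⟨s, hs, hjs⟩ := hb j hjr
      refine ⟨s - q (ψ₁ l), (hP'mem _).2 ?_, ?_⟩
      · have := Q.add_mem_points hs (Q.lattice.neg_mem hlat)
        convert this using 1
        abel
      · rw [hdist]
        exact hjs.trans (hscale l).2
  obtain ⟨ψ, B, hψ, hev⟩ := eventually_matched_isometryImage P' y A' hy'
  refine ⟨z₀, B, x, fun l => n (ψ l), fun l => -x (n (ψ l)) (i (ψ₁ (ψ l))), hx,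
    hφ.comp (hψ₁.comp hψ), fun R ε hε => ?_⟩
  filter_upwards [hev R ε hε] with l hl
  simpa only [hy, sub_eq_add_neg] using hl

/-- **A periodic configuration charged by Lennard-Jones ground states is a periodic minimiser**
(`e(Q) ≤ e*`, hence least): the rotated recentred copy in `𝔏` has energy per particle `e*`
(part III) and the same energy per particle as `Q`. [folklore] -/
theorem energyPerParticle_le_eStar_of_charged {Q : PeriodicConfiguration 3}
    (x : (N : ℕ) → Fin N → E3) (hx : ∀ N, IsGroundState lennardJones (x N))
    (h : ∀ R ε : ℝ, 0 < R → 0 < ε → ∃ᶠ N in atTop, ∃ (i : Fin N) (A : E3 →ₗᵢ[ℝ] E3),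
      ∃ q ∈ Q.points,
        (∀ s ∈ Q.points, dist s q ≤ R → ∃ j, dist (x N j) (x N i + A (s - q)) ≤ ε) ∧
        (∀ j, dist (x N j) (x N i) ≤ R → ∃ s ∈ Q.points, dist (x N j) (x N i + A (s - q)) ≤ ε)) :
    Q.energyPerParticle lennardJones ≤ eStar := by
  obtain ⟨z, B, hL⟩ := exists_isLocalLimit_of_charged x hx h
  have h1 := energyPerParticle_le_eStar_of_isLocalLimit hL
  rwa [PeriodicConfiguration.energyPerParticle_isometryImage,
    PeriodicConfiguration.energyPerParticle_translate] at h1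

/-- … hence attains the least periodic energy per particle. [folklore] -/
theorem isLeast_of_charged {Q : PeriodicConfiguration 3}
    (x : (N : ℕ) → Fin N → E3) (hx : ∀ N, IsGroundState lennardJones (x N))
    (h : ∀ R ε : ℝ, 0 < R → 0 < ε → ∃ᶠ N in atTop, ∃ (i : Fin N) (A : E3 →ₗᵢ[ℝ] E3),
      ∃ q ∈ Q.points,
        (∀ s ∈ Q.points, dist s q ≤ R → ∃ j, dist (x N j) (x N i + A (s - q)) ≤ ε) ∧
        (∀ j, dist (x N j) (x N i) ≤ R → ∃ s ∈ Q.points, dist (x N j) (x N i + A (s - q)) ≤ ε)) :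
    IsLeast (Set.range fun Q' : PeriodicConfiguration 3 => Q'.energyPerParticle lennardJones)
      (Q.energyPerParticle lennardJones) := by
  refine ⟨⟨Q, rfl⟩, ?_⟩
  rintro _ ⟨Q', rfl⟩
  exact (energyPerParticle_le_eStar_of_charged x hx h).trans (eStar_le Q')

/-- … and `KeplerBound` holds. [folklore] -/
theorem keplerBound_of_charged {Q : PeriodicConfiguration 3}
    (x : (N : ℕ) → Fin N → E3) (hx : ∀ N, IsGroundState lennardJones (x N))
    (h : ∀ R ε : ℝ, 0 < R → 0 < ε → ∃ᶠ N in atTop, ∃ (i : Fin N) (A : E3 →ₗᵢ[ℝ] E3),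
      ∃ q ∈ Q.points,
        (∀ s ∈ Q.points, dist s q ≤ R → ∃ j, dist (x N j) (x N i + A (s - q)) ≤ ε) ∧
        (∀ j, dist (x N j) (x N i) ≤ R → ∃ s ∈ Q.points, dist (x N j) (x N i + A (s - q)) ≤ ε)) :
    KeplerBound :=
  keplerBound_of_le_eStar (energyPerParticle_le_eStar_of_charged x hx h)

/-- **The hypothesis of the shared item `ChargedPeriodicIsOptimal` (stmt-AtomisticToContinuum-2913)
suffices**: a positive density `ρN` of charged particles, frequently in `N`, gives in particular
one charged particle; so such a `Q` attains the least periodic energy per particle. (The item is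
then `fun Q hQ => isLeast_of_charged_density hQ`.) [folklore] -/
theorem isLeast_of_charged_density {Q : PeriodicConfiguration 3}
    (hQ : ∃ x : (N : ℕ) → (Fin N → E3), (∀ N, IsGroundState lennardJones (x N)) ∧
      ∀ R ε : ℝ, 0 < R → 0 < ε → ∃ ρ : ℝ, 0 < ρ ∧ ∃ᶠ N : ℕ in atTop, ρ * (N : ℝ) ≤
        (Nat.card {i : Fin N // ∃ A : E3 →ₗᵢ[ℝ] E3, ∃ q ∈ Q.points,
          (∀ s ∈ Q.points, dist s q ≤ R → ∃ j : Fin N, dist (x N j) (x N i + A (s - q)) ≤ ε) ∧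
          (∀ j : Fin N, dist (x N j) (x N i) ≤ R →
            ∃ s ∈ Q.points, dist (x N j) (x N i + A (s - q)) ≤ ε)} : ℝ)) :
    IsLeast (Set.range fun Q' : PeriodicConfiguration 3 => Q'.energyPerParticle lennardJones)
      (Q.energyPerParticle lennardJones) := by
  obtain ⟨x, hx, hd⟩ := hQ
  refine isLeast_of_charged x hx fun R ε hR hε => ?_
  obtain ⟨ρ, hρ, hfr⟩ := hd R ε hR hε
  refine (hfr.and_eventually (eventually_ge_atTop 1)).mono ?_
  rintro N ⟨hcard, hN1⟩
  have hNpos : (0 : ℝ) < N := by exact_mod_cast hN1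
  have hpos : (0 : ℝ) < Nat.card {i : Fin N // ∃ A : E3 →ₗᵢ[ℝ] E3, ∃ q ∈ Q.points,
      (∀ s ∈ Q.points, dist s q ≤ R → ∃ j : Fin N, dist (x N j) (x N i + A (s - q)) ≤ ε) ∧
      (∀ j : Fin N, dist (x N j) (x N i) ≤ R →
        ∃ s ∈ Q.points, dist (x N j) (x N i + A (s - q)) ≤ ε)} :=
    lt_of_lt_of_le (mul_pos hρ hNpos) hcard
  have hne : Nonempty {i : Fin N // ∃ A : E3 →ₗᵢ[ℝ] E3, ∃ q ∈ Q.points,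
      (∀ s ∈ Q.points, dist s q ≤ R → ∃ j : Fin N, dist (x N j) (x N i + A (s - q)) ≤ ε) ∧
      (∀ j : Fin N, dist (x N j) (x N i) ≤ R →
        ∃ s ∈ Q.points, dist (x N j) (x N i + A (s - q)) ≤ ε)} := by
    by_contra h0
    rw [not_nonempty_iff] at h0
    rw [Nat.card_of_isEmpty] at hpos
    simp at hpos
  obtain ⟨⟨i, A, q, hq, ha, hb⟩⟩ := hne
  exact ⟨i, A, q, hq, ha, hb⟩

end Summit.AtomisticToContinuum.Crystallization.Theorems.KeplerBoundLocalLimit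

end
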